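import Summits.ValiantsHypothesis.ValiantsHypothesis.Theses.ProjectionStability
import Summits.ValiantsHypothesis.ValiantsHypothesis.Theses.ProjectionRigidity
import Literature.Computability.AlgebraicComplexity.DeterminantalComplexityProofs

/-!
# Disproof attempts — `ProjectionStability.OptStep` (crux stmt-ValiantsHypothesis-17835) — findings

Crux: `OptStep = ∀ n ≥ 3, Opt n → Uniq n → Opt (n+1)` with `Opt n := 2ⁿ − 1 ≤ pdc(per_n)`
(`pdc = detProjectionComplexity`: least `m` with `per_n` a Valiant projection of `DET_m`, every cell a
variable or a constant) and `Uniq n :=` any two optimal (`pdc × pdc`) projections of `per_n` are related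
by constant gauge `GL × GL`, a substitution `γ ∈ permSymmetrySubst ℂ n`, and possibly matrix transpose
(`optStep_iff` below, `Iff.rfl`).

## Verdict of cycle 1 (cdisprove, 2026-08-17): NO KILL; the crux is UNFALSIFIABLE except through ONE computation.

READ-BACK (W.lean rc 0): no junk — `2 ^ n - 1` is truncated subtraction of `1 ≤ 2ⁿ`; `pdc` is an
attained `sInf` over `ℂ` (`exists_isDetProjection`, Grenet); `permSymmetrySubst` is the PROJECTIVE
normaliser (it contains `x ↦ 2x`, which scales `per_n`), so `Uniq n` is slightly WEAKER than "modulo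
`G_per`" — harmless (`det P · det Q` absorbs the unit) and it only makes `OptStep` imperceptibly stronger.

(a) LOAD-BEARING ANALYSIS — all as theorems below.
* `Opt 3` is a theorem of the tree (ABV 2017; `opt_three`, the proof inside `closes`).  Hence
  `OptStep → UniqBase → 15 ≤ pdc(per_4)` (`optStep_uniqBase_pdcPerFour`) and the planner's kill
  criterion is EXACTLY a theorem: `UniqBase → IsDetProjection per_4 m → m ≤ 14 → ¬ OptStep`
  (`not_optStep_of_uniqBase_of_isDetProjection`).  Conversely `¬ OptStep ↔ ∃ n ≥ 3, Opt n ∧ Uniq n ∧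
  pdc(per_{n+1}) ≤ 2^{n+1} − 2` (`not_optStep_iff`), and for `n ≥ 4` the conjunct `Opt n` is the open
  target itself: THE ONLY LEVEL AT WHICH `OptStep` CAN EVER BE REFUTED IS `n = 3`, and there it needs
  BOTH the open base `Uniq 3 = UniqBase` (stmt-17836) AND a `≤ 14 × 14` projection of `per_4` (open:
  Hüttenhain–Ikenmeyer 2016 p. 3 "determining bdc(per_4) is currently out of reach", even for 0/1
  constants; no representation of `per_4` below Grenet's 15 is known in ANY model, 9 ≤ dc(per_4) ≤ 15).
* Without `Uniq n` the crux is the parent's `ProjLaplaceDoubling` (open); without `Opt n` it is open;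
  without `n ≥ 3` the instances `n = 0, 1, 2` are TRUE (`pdc(per_1) = 1`, `pdc(per_2) = 3`,
  `pdc(per_3) ≥ 7`: `optStepBody_zero`, `optStepBody_one`, `optStepBody_two` below, sorry-free).
  So NO `optStep_false_without_<H>` lemma exists: every mutation is open or true, never refutable —
  recorded as the implications `optStep_of_withoutUniq`, `optStep_of_withoutOpt`, `optStep_of_withoutGe`.
* At `n = 3` the hypothesis `Uniq 3` is NOT load-bearing for truth: `PdcPerFour → (Opt 3 → Uniq 3 → Opt 4)`
  (`optStepBody_three_of_pdcPerFour`); it is load-bearing only for the intended PROOF (window cores).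
(b) TIGHTNESS.  The bound `2^(n+1) − 1` of the conclusion is attained at the small levels:
  `pdc(per_1) = 1`, `pdc(per_2) = 3` (`detProjectionComplexity_perPoly_one/two`, proofs after the
  sibling workfile `Cruxes/PdcQpOfVp/Disproof.lean`, refuter-cdisprove-16003); at `n + 1 ≥ 3` tightness
  is Grenet (`pdc ≤ 2ⁿ − 1`, the picked line's stub S2 / parent support `GrenetProjection`, prover-side).
(c) NATURAL STRENGTHENINGS.  "drop the −1" (`2^(n+1) ≤ pdc(per_{n+1})`) is false at n = 0, 1 by (b)
  (`not_opt_succ_strict_zero/one`); at n = 3 it is false iff Grenet (S2).  "pdc = dc on permanents" is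
  false at n = 2 (`dc(per_2) = 2 < 3`, sibling file) — irrelevant to OptStep but it kills any plan to
  import affine lower bounds verbatim.  Characteristic 2 (barrier `PermanentCharTwo`): `Opt n` fails
  from n = 3 (`per = det`), so the char-2 analogue of OptStep is VACUOUSLY TRUE, not false — no small
  model there either.
(d) TARGETS (picked line `Lines/Sketch.lean`, symmetry patching + LR17 Thm 2.8; payload.targets = []).
  Registered stubs: S2 (Grenet is a strict projection) — LANDED by a prover
  (`Theorems/ProjectionStabilityOptStepStubGrenetProjection.lean`); S5/S6 (transport of half-equivariance
  along gauge / transpose / `permSymmetrySubst`) — LANDED (`…StubHalfEqTransportGauge.lean`,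
  `…StubHalfEqTransportSymm.lean`); S3 (Grenet left-monomial equivariant) TRUE on paper (LR17 §2.2; the
  sign `(-1)^(e univ + e ∅)` is irrelevant); S4 (gauge stabiliser of `Grenet.repr` = scalars) TRUE on
  paper for every `n ≥ 1` and every `e`: the coefficient matrix of `X (j,c)`, `1 ≤ c ≤ n−2`, is a partial
  permutation matrix, `P·M = M·Q` forces `P_{A,S} = 0` unless `A = S` (take `j ∉ S`, `j ∈ A`), the
  constant part glues `P = Q` on `S ∉ {∅, univ}`, the `c = 0` / `c = n−1` variables pin the `∅`-column of
  `P` and the `univ`-row of `Q`, and Johnson-graph connectivity equalises the diagonal — no attack.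
  S7 (`stub_symStep`, THE BET: every optimal projection of `per_{n+1}` is half-equivariant) is, like the
  crux, refutable ONLY at n = 3 and only MODULO `UniqBase ∧ PdcPerFour`: the witness would be a 15 × 15
  projection of `per_4` that is not `leftMonomialSubst`-equivariant (nor its variable-transpose).
  Computational probe: SAT enumeration of single-variable-edge DAG branching programs ("projection ABPs")
  computing `per_4` with 14 internal vertices, every solution tested numerically for gauge-equivalence to
  Grenet ∘ (S₄ × S₄ ⋊ transpose) and for half-equivariance — see SEARCH RECORD (job ids).  CAVEAT learnt
  from the sibling refuter's landed `UniqStep/Negative/UniqThreeFalseWithSignedEntries.lean`: with SIGNED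
  variable entries `Uniq 3` is false by the pure Koszul twist, whose cancelling junk monomial
  `X(0,0)·X(1,0)` is NOT a partial-permutation monomial — so the PPM-universe encoding (E2) is blind to
  Koszul-type cancellation; the row-multilinear universe variant (625 monomials) admits it.
(e) NEAR-MISSES: none in Lean (nothing false was found to be nearly provable); the open computation is
  recorded as a comment, NOT as a sorried claim.

WHY IT RESISTS: `OptStep` is an implication between two open exponential lower bounds whose only
instance with decidable hypotheses (n = 3) has an undecidable-in-practice conclusion (`pdc(per_4) ≥ 15`,
a finite but astronomically large search: HI16 could not settle even the 0/1 case); and its extra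
hypothesis `Uniq 3` is itself the open finite base of the route.  A disproof is exactly as hard as
(UniqBase) + (beating Grenet at n = 4).
-/

namespace Summit.ValiantsHypothesis.ValiantsHypothesis.Cruxes.OptStep.Disproof

set_option linter.dupNamespace false
set_option linter.unusedVariables false

open MvPolynomial Literature.Computability.AlgebraicComplexity
open Summit.ValiantsHypothesis.ValiantsHypothesis.Theses.ProjectionStability (OptStep UniqBase UniqStep)
open Summit.ValiantsHypothesis.ValiantsHypothesis.Theses.ProjectionRigidity (ProjOptimalUnique ProjLaplaceDoubling PdcPerFour GrenetProjection)

/-! ## The crux unfolded -/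

/-- `pdc(per_n)` over `ℂ`. -/
noncomputable abbrev pdcPer (n : ℕ) : ℕ := detProjectionComplexity (perPoly (Fin n) ℂ)

/-- `Opt n`: Grenet is optimal among projections at level `n`. -/
def Opt (n : ℕ) : Prop := 2 ^ n - 1 ≤ pdcPer n

/-- `Uniq n`: optimal projections of `per_n` are unique modulo constant gauge × `permSymmetrySubst` ×
transpose (verbatim the hypothesis of the crux). -/
def Uniq (n : ℕ) : Prop :=
  ∀ A B : Matrix (Fin (pdcPer n)) (Fin (pdcPer n)) (MvPolynomial (Fin n × Fin n) ℂ),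
    (∀ i j, (∃ v, A i j = MvPolynomial.X v) ∨ ∃ c, A i j = MvPolynomial.C c) →
    (∀ i j, (∃ v, B i j = MvPolynomial.X v) ∨ ∃ c, B i j = MvPolynomial.C c) →
    A.det = perPoly (Fin n) ℂ → B.det = perPoly (Fin n) ℂ →
    ∃ (P Q : GL (Fin (pdcPer n)) ℂ) (γ : GL (Fin n × Fin n) ℂ), γ ∈ permSymmetrySubst ℂ n ∧
      (B = (P : Matrix _ _ ℂ).map MvPolynomial.C * Matrix.linSubstEntries γ A * (Q : Matrix _ _ ℂ).map MvPolynomial.C ∨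
        B = (P : Matrix _ _ ℂ).map MvPolynomial.C * (Matrix.linSubstEntries γ A).transpose *
          (Q : Matrix _ _ ℂ).map MvPolynomial.C)

/-- The body of the crux at level `n` (no side condition on `n`). -/
def OptStepBody (n : ℕ) : Prop := Opt n → Uniq n → Opt (n + 1)

/-- The crux is literally `∀ n ≥ 3, OptStepBody n`. -/
theorem optStep_iff : OptStep ↔ ∀ n ≥ 3, OptStepBody n := Iff.rfl

/-! ## (a) Load-bearing analysis -/

/-- `Opt 3`: `7 ≤ dc(per_3) ≤ pdc(per_3)` (Alper–Bogart–Velasco 2017, in tree; this is step (1) of the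
route's `closes`, copied). [cite: AlperBogartVelasco2017, Cor. 1.4] -/
theorem opt_three : Opt 3 := by
  unfold Opt pdcPer
  have h2 : (2 : ℂ) ≠ 0 := two_ne_zero
  obtain ⟨A, hA⟩ := hasDetRepr_determinantalComplexity_holds (perPoly (Fin 3) ℂ)
  obtain ⟨W, hW, hvan⟩ := AlperBogartVelasco.exists_subspace_of_isAffineDetRepr_perPoly h2 le_rfl hA
  have hfin : Module.finrank ℂ W ≤ 3 := by
    refine AlperBogartVelasco.finrank_le_three_of_subperm_two_vanish W fun x hx r c => ?_
    have key : MvPolynomial.eval x (MvPolynomial.pderiv (r, c) (perPoly (Fin 3) ℂ)) =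
        ((Matrix.of fun i j => x (i, j)).submatrix r.succAbove c.succAbove).permanent := by
      rw [VonZurGathen.pderiv_perPoly, ← MvPolynomial.aeval_eq_eval, VonZurGathen.aeval_subperm_X,
        Matrix.subperm_eq_permanent_of_equiv _ (finSuccAboveEquiv c) (finSuccAboveEquiv r)]
      rfl
    rw [← key]
    exact hvan x hx (r, c)
  have h7 : 2 ^ 3 - 1 ≤ determinantalComplexity (perPoly (Fin 3) ℂ) := by
    norm_num at hW ⊢
    omega
  exact h7.trans (determinantalComplexity_le_detProjectionComplexity_holds _)

/-- The crux consumed at its ONLY level with decidable hypotheses: `OptStep ∧ UniqBase ⇒ 15 ≤ pdc(per_4)`. -/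
theorem optStep_uniqBase_pdcPerFour (hO : OptStep) (hB : UniqBase) : 2 ^ 4 - 1 ≤ pdcPer 4 :=
  hO 3 le_rfl opt_three hB

/-- **The kill criterion is a theorem**: a projection of `per_4` of ANY size `m ≤ 14` together with the
finite base `UniqBase` refutes `OptStep`.  (No such projection is known; HI16 p. 3.) -/
theorem not_optStep_of_uniqBase_of_isDetProjection (hB : UniqBase) {m : ℕ} (hm : m ≤ 14)
    (h : IsDetProjection (perPoly (Fin 4) ℂ) m) : ¬ OptStep := fun hO => by
  have h15 := optStep_uniqBase_pdcPerFour hO hB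
  have hle : pdcPer 4 ≤ m := Nat.sInf_le h
  omega

/-- … and conversely a refutation at level 3 NEEDS such a projection: if `OptStepBody 3` fails then
`pdc(per_4) ≤ 14` (and `Uniq 3` holds). -/
theorem pdcPerFour_le_of_not_optStepBody_three (h : ¬ OptStepBody 3) : pdcPer 4 ≤ 14 ∧ Uniq 3 := by
  unfold OptStepBody at h
  push Not at h
  obtain ⟨-, hU, hlt⟩ := h
  unfold Opt at hlt
  change ¬ (2 ^ 4 - 1 ≤ pdcPer 4) at hlt
  exact ⟨by omega, hU⟩

/-- `¬ OptStep` unfolded: some level `n ≥ 3` has `Opt n ∧ Uniq n` but `pdc(per_{n+1}) ≤ 2^{n+1} − 2`.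
For `n ≥ 4` the first conjunct is the open target, so only `n = 3` is ever usable. -/
theorem not_optStep_iff :
    ¬ OptStep ↔ ∃ n ≥ 3, Opt n ∧ Uniq n ∧ pdcPer (n + 1) ≤ 2 ^ (n + 1) - 2 := by
  rw [optStep_iff]
  push Not
  refine exists_congr fun n => ?_
  refine and_congr_right fun hn => ?_
  unfold OptStepBody Opt
  constructor
  · rintro h
    push Not at h
    obtain ⟨ho, hu, hlt⟩ := h
    exact ⟨ho, hu, by omega⟩
  · rintro ⟨ho, hu, hle⟩
    push Not
    have : 1 ≤ 2 ^ (n + 1) := Nat.one_le_two_pow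
    exact ⟨ho, hu, by omega⟩

/-- At `n = 3` the uniqueness hypothesis is not load-bearing for TRUTH: `PdcPerFour` alone gives the
level-3 body (it is load-bearing only for the intended window-core proof). -/
theorem optStepBody_three_of_pdcPerFour (h4 : 2 ^ 4 - 1 ≤ pdcPer 4) : OptStepBody 3 :=
  fun _ _ => h4

/-! ### Dropping hypotheses: each mutation is an OPEN statement (or true), never a refutable one -/

/-- The crux without `Uniq n` = the parent's `ProjLaplaceDoubling` (stmt-16005's shape): OPEN. -/
def OptStepWithoutUniq : Prop := ∀ n ≥ 3, Opt n → Opt (n + 1)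

/-- The crux without `Opt n`: OPEN (stronger than the crux). -/
def OptStepWithoutOpt : Prop := ∀ n ≥ 3, Uniq n → Opt (n + 1)

/-- The crux without `n ≥ 3`: the extra instances n = 0, 1, 2 are TRUE (below), so this is
equivalent in truth value to the crux — OPEN. -/
def OptStepWithoutGe : Prop := ∀ n, OptStepBody n

theorem optStep_of_withoutUniq (h : OptStepWithoutUniq) : OptStep := fun n hn ho _ => h n hn ho
theorem optStep_of_withoutOpt (h : OptStepWithoutOpt) : OptStep := fun n hn _ hu => h n hn hu
theorem optStep_of_withoutGe (h : OptStepWithoutGe) : OptStep := fun n _ => h n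

/-! ## Small models: `pdc(per_n)` for `n ≤ 2` (proofs after the sibling workfile
`Cruxes/PdcQpOfVp/Disproof.lean`, refuter-cdisprove-stmt-16003, 2026-08-17; copied, not imported) -/

/-- Substituting `a` into `DET_m` gives the determinant of the substituted matrix. [folklore] -/
theorem aeval_detPoly {σ : Type*} {m : ℕ} (a : Fin m × Fin m → MvPolynomial σ ℂ) :
    aeval a (detPoly (Fin m) ℂ) = (Matrix.of fun i j => a (i, j)).det := by
  unfold detPoly
  rw [AlgHom.map_det]
  congr 1
  ext i j
  simp [Matrix.mvPolynomialX_apply]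

/-- `per_2 = x₀₀ x₁₁ + x₀₁ x₁₀`. [folklore] -/
theorem perPoly_two_eq : perPoly (Fin 2) ℂ = X (0, 0) * X (1, 1) + X (0, 1) * X (1, 0) := by
  simp [perPoly, Matrix.permanent_fin_two_row]

/-- `per_2 (t, t, t, t) = 2t²`. [folklore] -/
theorem eval_const_perPoly_two (t : ℂ) : eval (fun _ => t) (perPoly (Fin 2) ℂ) = t * t + t * t := by
  rw [perPoly_two_eq]; simp only [map_add, map_mul, eval_X]

/-- No projection of `DET_m`, `m ≤ 2`, equals `per_2` (second differences along the diagonal line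
`x = (t,t,t,t)`). [folklore] -/
theorem not_isDetProjection_perPoly_two_of_le_two {m : ℕ} (hm : m ≤ 2) :
    ¬ IsDetProjection (perPoly (Fin 2) ℂ) m := by
  rintro ⟨a, ha, heq⟩
  rw [aeval_detPoly] at heq
  have E : ∀ t : ℂ, t * t + t * t = eval (fun _ => t) (Matrix.of fun i j => a (i, j)).det :=
    fun t => by rw [← eval_const_perPoly_two, heq]
  have h0 := E 0
  have h1 := E 1
  have h2 := E 2
  interval_cases m
  · simp only [Matrix.det_isEmpty, map_one] at h0 h1 h2
    have hh : (4 : ℂ) = 0 := by linear_combination h2 - 2 * h1 + h0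
    norm_num at hh
  · simp only [Matrix.det_fin_one, Matrix.of_apply] at h0 h1 h2
    rcases ha (0, 0) with ⟨v, e⟩ | ⟨c, e⟩ <;> simp only [e, eval_X, eval_C] at h0 h1 h2 <;>
    · have hh : (4 : ℂ) = 0 := by linear_combination h2 - 2 * h1 + h0
      norm_num at hh
  · simp only [Matrix.det_fin_two, Matrix.of_apply, map_sub, map_mul] at h0 h1 h2
    rcases ha (0, 0) with ⟨v₀, e₀⟩ | ⟨c₀, e₀⟩ <;> rcases ha (1, 1) with ⟨v₃, e₃⟩ | ⟨c₃, e₃⟩ <;>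
      rcases ha (0, 1) with ⟨v₁, e₁⟩ | ⟨c₁, e₁⟩ <;> rcases ha (1, 0) with ⟨v₂, e₂⟩ | ⟨c₂, e₂⟩ <;>
      simp only [e₀, e₁, e₂, e₃, eval_X, eval_C] at h0 h1 h2 <;>
      first
        | (have hh : (4 : ℂ) = 0 := by linear_combination h2 - 2 * h1 + h0); norm_num at hh
        | (have hh : (2 : ℂ) = 0 := by linear_combination h2 - 2 * h1 + h0); norm_num at hh
        | (have hh : (6 : ℂ) = 0 := by linear_combination h2 - 2 * h1 + h0); norm_num at hh

/-- Grenet's `3 × 3` projection: `per_2 = det [[0, x₀₀, x₀₁], [x₁₁, -1, 0], [x₁₀, 0, -1]]`. [folklore] -/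
theorem isDetProjection_perPoly_two_three : IsDetProjection (perPoly (Fin 2) ℂ) 3 := by
  let M : Matrix (Fin 3) (Fin 3) (MvPolynomial (Fin 2 × Fin 2) ℂ) :=
    !![C 0, X (0, 0), X (0, 1); X (1, 1), C (-1), C 0; X (1, 0), C 0, C (-1)]
  refine ⟨fun p => M p.1 p.2, fun p => ?_, ?_⟩
  · obtain ⟨i, j⟩ := p
    fin_cases i <;> fin_cases j
    · exact Or.inr ⟨0, rfl⟩
    · exact Or.inl ⟨(0, 0), rfl⟩
    · exact Or.inl ⟨(0, 1), rfl⟩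
    · exact Or.inl ⟨(1, 1), rfl⟩
    · exact Or.inr ⟨-1, rfl⟩
    · exact Or.inr ⟨0, rfl⟩
    · exact Or.inl ⟨(1, 0), rfl⟩
    · exact Or.inr ⟨0, rfl⟩
    · exact Or.inr ⟨-1, rfl⟩
  · rw [aeval_detPoly, perPoly_two_eq, Matrix.det_fin_three]
    simp [M]

/-- **`pdc(per_2) = 3 = 2² − 1`** — `Opt 2` holds with equality. [folklore] -/
theorem detProjectionComplexity_perPoly_two : pdcPer 2 = 3 := by
  have h3 := isDetProjection_perPoly_two_three
  unfold pdcPer detProjectionComplexity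
  apply le_antisymm (Nat.sInf_le h3)
  by_contra hlt
  push Not at hlt
  have hmem : sInf {m | IsDetProjection (perPoly (Fin 2) ℂ) m} ∈
      {m | IsDetProjection (perPoly (Fin 2) ℂ) m} := Nat.sInf_mem ⟨3, h3⟩
  exact not_isDetProjection_perPoly_two_of_le_two (by omega) hmem

/-- **`pdc(per_1) = 1 = 2¹ − 1`** — `Opt 1` holds with equality. [folklore] -/
theorem detProjectionComplexity_perPoly_one : pdcPer 1 = 1 := by
  have hper1 : perPoly (Fin 1) ℂ = X (0, 0) := by
    simp [perPoly, Matrix.permanent_unique, Matrix.mvPolynomialX_apply]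
  have h1 : IsDetProjection (perPoly (Fin 1) ℂ) 1 := by
    refine ⟨fun _ => X (0, 0), fun _ => Or.inl ⟨(0, 0), rfl⟩, ?_⟩
    rw [aeval_detPoly, Matrix.det_fin_one, Matrix.of_apply, hper1]
  have h0 : ¬ IsDetProjection (perPoly (Fin 1) ℂ) 0 := by
    rintro ⟨a, -, heq⟩
    rw [aeval_detPoly, Matrix.det_isEmpty, hper1] at heq
    have := congr_arg (eval fun _ => (0 : ℂ)) heq
    simp at this
  unfold pdcPer detProjectionComplexity
  apply le_antisymm (Nat.sInf_le h1)
  by_contra hlt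
  push Not at hlt
  have hmem : sInf {m | IsDetProjection (perPoly (Fin 1) ℂ) m} ∈
      {m | IsDetProjection (perPoly (Fin 1) ℂ) m} := Nat.sInf_mem ⟨1, h1⟩
  have hz : sInf {m | IsDetProjection (perPoly (Fin 1) ℂ) m} = 0 := by omega
  rw [hz] at hmem
  exact h0 hmem

/-! ### The instances excluded by `n ≥ 3` are TRUE: the side condition is not load-bearing -/

/-- `OptStepBody 0`: its conclusion `Opt 1` holds outright. -/
theorem optStepBody_zero : OptStepBody 0 := fun _ _ => by
  unfold Opt; rw [detProjectionComplexity_perPoly_one]; norm_num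

/-- `OptStepBody 1`: its conclusion `Opt 2` holds outright. -/
theorem optStepBody_one : OptStepBody 1 := fun _ _ => by
  unfold Opt; rw [detProjectionComplexity_perPoly_two]; norm_num

/-- `OptStepBody 2`: its conclusion `Opt 3` holds outright (ABV). -/
theorem optStepBody_two : OptStepBody 2 := fun _ _ => opt_three

/-- Hence the crux is equivalent to its `n`-unrestricted form. -/
theorem optStep_iff_withoutGe : OptStep ↔ OptStepWithoutGe := by
  refine ⟨fun h n => ?_, optStep_of_withoutGe⟩
  match n with
  | 0 => exact optStepBody_zero
  | 1 => exact optStepBody_one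
  | 2 => exact optStepBody_two
  | (k + 3) => exact h (k + 3) (by omega)

/-! ## (b) Tightness and (c) the strict strengthening fails at small levels -/

/-- The conclusion's bound cannot be raised by one at level 0 → 1: `¬ (2¹ ≤ pdc(per_1))`. -/
theorem not_opt_succ_strict_zero : ¬ (2 ^ 1 ≤ pdcPer 1) := by
  rw [detProjectionComplexity_perPoly_one]; omega

/-- … nor at level 1 → 2: `¬ (2² ≤ pdc(per_2))`. -/
theorem not_opt_succ_strict_one : ¬ (2 ^ 2 ≤ pdcPer 2) := by
  rw [detProjectionComplexity_perPoly_two]; omega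

/-- `per_0 = 1` is the empty determinant: `pdc(per_0) = 0`. [folklore] -/
theorem detProjectionComplexity_perPoly_zero : pdcPer 0 = 0 := by
  have h0 : IsDetProjection (perPoly (Fin 0) ℂ) 0 := by
    refine ⟨fun p => C 0, fun _ => Or.inr ⟨0, rfl⟩, ?_⟩
    rw [aeval_detPoly, Matrix.det_isEmpty]
    simp [perPoly, Matrix.permanent]
  unfold pdcPer detProjectionComplexity
  exact Nat.eq_zero_of_le_zero (Nat.sInf_le h0)

/-! ### `Uniq n` has honest (non-junk) instances at the degenerate levels -/

/-- `Uniq 0` holds: optimal projections of `per_0 = 1` are `0 × 0` matrices. -/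
theorem uniq_zero : Uniq 0 := by
  intro A B _ _ _ _
  have h0 := detProjectionComplexity_perPoly_zero
  haveI : IsEmpty (Fin (pdcPer 0)) := by rw [h0]; infer_instance
  refine ⟨1, 1, 1, Subgroup.one_mem _, Or.inl ?_⟩
  ext i j
  exact isEmptyElim i

/-- `Uniq 1` holds: the only optimal projection of `per_1 = x₀₀` is the `1 × 1` matrix `(x₀₀)`. -/
theorem uniq_one : Uniq 1 := by
  intro A B hA hB hdA hdB
  have h1 := detProjectionComplexity_perPoly_one
  haveI : Subsingleton (Fin (pdcPer 1)) := by rw [h1]; infer_instance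
  obtain ⟨k⟩ : Nonempty (Fin (pdcPer 1)) := by rw [h1]; infer_instance
  rw [Matrix.det_eq_elem_of_subsingleton _ k] at hdA hdB
  have hAB : B = A := by
    ext i j
    rw [Subsingleton.elim i k, Subsingleton.elim j k, hdA, hdB]
  refine ⟨1, 1, 1, Subgroup.one_mem _, Or.inl ?_⟩
  simp [hAB, Matrix.map_one C C_0 C_1]

/-- So the natural strengthening "drop the −1 in the conclusion" of the (n-unrestricted) crux body is
FALSE, with its hypotheses honestly discharged at n = 0 (`Opt 0`, `Uniq 0`). -/
theorem not_optStepBody_strict :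
    ¬ (∀ n, Opt n → Uniq n → 2 ^ (n + 1) ≤ pdcPer (n + 1)) := fun h =>
  not_opt_succ_strict_zero (h 0 (by unfold Opt; norm_num) uniq_zero)

/-- … and also at n = 1 (`Opt 1`, `Uniq 1` discharged): `¬ (2² ≤ pdc(per_2))`. -/
theorem not_optStepBody_strict_one :
    ¬ (Opt 1 → Uniq 1 → 2 ^ 2 ≤ pdcPer 2) := fun h =>
  not_opt_succ_strict_one (h (by unfold Opt; rw [detProjectionComplexity_perPoly_one]; norm_num) uniq_one)

/-! ## (f) Position of the crux in the cone (all definitional or one-liners)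

The parent route's items, by name: `ProjOptimalUnique = ∀ n ≥ 3, Uniq n` (global uniqueness),
`ProjLaplaceDoubling = ProjOptimalUnique → OptStepWithoutUniq`, `PdcPerFour = (pdc(per_4) = 15)`,
`GrenetProjection = ∀ n ≥ 1, IsDetProjection per_n (2ⁿ − 1)`. -/

/-- The finite base of this route is literally `Uniq 3`. -/
theorem uniqBase_iff : UniqBase ↔ Uniq 3 := Iff.rfl

/-- The parent's global uniqueness crux is literally `∀ n ≥ 3, Uniq n`. -/
theorem projOptimalUnique_iff : ProjOptimalUnique ↔ ∀ n ≥ 3, Uniq n := Iff.rfl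

/-- The parent's doubling crux is literally "global uniqueness ⇒ the crux without `Uniq`". -/
theorem projLaplaceDoubling_iff : ProjLaplaceDoubling ↔ (ProjOptimalUnique → OptStepWithoutUniq) := Iff.rfl

/-- `OptStep` is STRONGER than the parent's `ProjLaplaceDoubling` (it gets only level-`n` uniqueness):
so every refutation of the parent's doubling refutes this crux — but `¬ ProjLaplaceDoubling` needs
GLOBAL uniqueness as a conjunct, which is hopeless to establish; no leverage. -/
theorem projLaplaceDoubling_of_optStep (h : OptStep) : ProjLaplaceDoubling :=
  fun hU n hn ho => h n hn ho (hU n hn)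

/-- With the base and Grenet's projection (parent support, provable now) the crux DECIDES the parent's
certified-computation item: `OptStep → UniqBase → GrenetProjection → PdcPerFour`. -/
theorem pdcPerFour_of_optStep (hO : OptStep) (hB : UniqBase) (hG : GrenetProjection) : PdcPerFour := by
  have h15 := optStep_uniqBase_pdcPerFour hO hB
  have hle : pdcPer 4 ≤ 2 ^ 4 - 1 := Nat.sInf_le (hG 4 (by norm_num))
  unfold PdcPerFour
  change pdcPer 4 = 15
  omega

/-- Conversely `PdcPerFour` settles the crux at level 3 and leaves exactly the tail `n ≥ 4`, every
instance of which has the open target `Opt n` (n ≥ 4) as a hypothesis: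
`OptStep ↔ OptStepBody 3 ∧ ∀ n ≥ 4, OptStepBody n`. -/
theorem optStep_iff_three_and_tail : OptStep ↔ OptStepBody 3 ∧ ∀ n ≥ 4, OptStepBody n := by
  rw [optStep_iff]
  refine ⟨fun h => ⟨h 3 le_rfl, fun n hn => h n (by omega)⟩, fun ⟨h3, h4⟩ n hn => ?_⟩
  rcases Nat.lt_or_ge n 4 with hlt | hge
  · obtain rfl : n = 3 := by omega
    exact h3
  · exact h4 n hge

/-- In particular, modulo the two finite computations of the route (`UniqBase`, `PdcPerFour`) a
refutation of `OptStep` must live at a level `n ≥ 4` and exhibit `Opt n` there — i.e. PROVE the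
open target at some `n ≥ 4` and beat Grenet at `n + 1`.  This is why the crux resists disproof. -/
theorem not_optStep_iff_tail (h4 : PdcPerFour) :
    ¬ OptStep ↔ ∃ n ≥ 4, Opt n ∧ Uniq n ∧ pdcPer (n + 1) ≤ 2 ^ (n + 1) - 2 := by
  rw [not_optStep_iff]
  constructor
  · rintro ⟨n, hn, ho, hu, hle⟩
    rcases Nat.lt_or_ge n 4 with hlt | hge
    · obtain rfl : n = 3 := by omega
      exfalso
      unfold PdcPerFour at h4
      change pdcPer 4 = 15 at h4
      change pdcPer 4 ≤ 2 ^ 4 - 2 at hle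
      omega
    · exact ⟨n, hge, ho, hu, hle⟩
  · rintro ⟨n, hn, ho, hu, hle⟩
    exact ⟨n, by omega, ho, hu, hle⟩

/-!
## SEARCH RECORD (computations; nothing here is claimed in Lean)

Model: single-variable-edge DAG branching programs ("projection ABPs"): vertices `s, 1, …, N, t`, one
label per ordered pair `u < v` among `none | ±1 | ±x_c`; polynomial = path sum.  An ABP with `N` internal
vertices is an affine determinantal representation of size `N + 1` (merge `s, t`, unit loops; the
length-parity sign is absorbed by negating all labels) and a genuine PROJECTION of `DET_{N+1}` iff the
sign pattern on variable edges is rank-one correctable by a diagonal `±1` gauge (checked per solution;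
`abp_search/emit_matrix.py` prints the projection form and re-verifies `det = per` by an independent
Laplace expansion).  Grenet = `N = 2ⁿ − 2`.  Orbit test per solution at `N = 2ⁿ − 2`: the multiset of
ranks of the `n²` coefficient matrices `B_c` and of the constant part (an invariant of
`B ↦ P·B(γx)·Q`, `γ` monomial × monomial × transpose, and of matrix transpose), then a numerical solve of
`P·G^{γ,T} = B·R` over `γ ∈ S_n × S_n × {1,τ}`, `T ∈ {1,ᵀ}` (the torus is absorbed by Grenet's two-sided
torus equivariance, in tree); half-equivariance test: exact numerical lifts of the generators of the
left (row-index) and right (column-index) monomial groups (adjacent transpositions; scaling one index by 2).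
* Encoding E1 (mod-3 evaluation DP at sample points + CEGAR), j023584: per_2 settled instantly (N = 1
  UNSAT; N = 2: exactly the 4 sign/transpose variants of Grenet₂, then UNSAT = complete), but per_3 at
  N = 6 returned no model in 10 min (evaluation constraints are parity-like for CDCL).  Abandoned.
* Encoding E2 (EXACT coefficient tracking over a finite monomial universe — default the 209
  partial-permutation monomials (PPM) of the 4 × 4 grid; variants: 625 row-multilinear (`rowml`), 2517
  multilinear — coefficients in {−1,0,1}, at most one positive and one negative contribution per
  (vertex, monomial); Grenet is inside; a model IS an exact solution; symmetry breaking: topological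
  order with non-decreasing max-in-neighbour, degree ≥ 1, label(s,1) ∈ {+1, +x₁₁}, and (rev. 2)
  sign-canonical vertices + tie-break).  LIMITATION (learnt from the sibling refuter's landed
  `UniqStep/Negative/UniqThreeFalseWithSignedEntries.lean`): the pure Koszul twist cancels the junk
  monomial `X(0,0)·X(1,0)`, which is not a PPM — E2-PPM is blind to Koszul-type cancellation, E2-rowml
  sees it (up to transpose).
  - per_3 (j023678): N = 4, 5 UNSAT in ≤ 1.1 s (consistent with dc(per_3) = 7); N = 6: the first 300
    solutions (cap) are ALL exact, ALL gauge-equivalent to Grenet₃ ∘ symmetry (numerical residual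
    ~1e-16), ALL half-equivariant (left side), 96 of them genuine projections (rank-one signs) — i.e.
    HI16 Prop. 9 re-found and extended to ±1 constants with cancellations inside this family.
  - per_4, ungraded, PPM, CaDiCaL 1.9.5 (j023676 N = 13/14 with constants, j023677 N = 13 homogeneous /
    N = 12, j023708 first-layer sub-case, j023957 rowml universe, j023678 N = 14 homogeneous 6000 s):
    NO MODEL FOUND in uninterrupted attempts of 1.5–2.4 h per case (the scheduler preempted and
    restarted these jobs several times) — INCLUDING the calibration instances N = 14 where Grenet₄
    exists.  So these runs carry NO evidence about N = 13: the instances (3·10⁵–1.4·10⁶ vars,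
    2–8·10⁶ clauses) are simply too hard for CDCL search as encoded (rev. 1).
  - per_4, graded sub-cases, PPM, CaDiCaL (j023961): strict layers 5-4-4 homogeneous: UNSAT PROVED
    (1077 s) — no strictly layered homogeneous signed single-variable ABP of shape 5-4-4 computes per_4
    under E2 semantics; strict 4-6-4 (Grenet's own shape) NOT re-found in 900 s (calibration failure
    again); strict 4-5-4 and 4-4-5 undecided at 1500 s each; 5-5-4, 4-5-5 and the weak-layered cases
    with constants still running at the time of writing (results → item evidence compute-j023961.json).
  - rev. 2 of the encoding (redundant CUT-COVER clauses: every position cut carries, for every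
    permutation σ, a constant or a cell of σ; sign-canonical vertices; tie-break) with kissat 4.0.4:
    j024737 (graded shapes incl. the 4-6-4 calibration, 4-5-4, 4-4-5, 5-5-4, 4-5-5, weak-layered
    N = 13/12 with constants), j024739 (ungraded N = 14/13, ± first-layer sub-case) — queued at the time
    of writing; their summaries are attached to the item automatically (compute-<id>.json) and are to be
    folded in at the next arming of this seat.
VERDICT OF THE COMPUTATION SO FAR: no projection of per_4 of size ≤ 14 found; one restricted shape
(5-4-4, homogeneous, PPM junk only) excluded; the unrestricted question — even for 0/1 constants (HI16) —
remains far out of reach of exact search, exactly as the planner's "why it might fail" anticipated.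
-/

end Summit.ValiantsHypothesis.ValiantsHypothesis.Cruxes.OptStep.Disproof
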